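import Literature.MathematicalPhysics.QuantumFieldTheory.Balaban1983to89.Node00.Record13SepCoPInhabitedOfThm1CoPGauge

/-!
# NODE 00 (YM-PLAN Track A) — STAGE 13: THE COLLARED MEMBER OF THE [15]-WITNESS FAMILY — `(M, M₁) = (L^j, L^j)` — for the R-ROAD of the (9)-step
# (dag-n07-e's floor-carrying tokens `Gauge152OfClassTopStepR ∕ Gauge9RegSepTopStepR … M c …`, binder `c ≤ ν.M₁`): the numerics, the witness `θ₁₅ᶜᶜᴹ(j)` and its faces

Cell `pub-ymgap`, seat `pub-ymgap-dag-n21-c` (g11), dag-lead WORDS-144 pen (γ) «THE WITNESS RE-PIN» (INBOX l.21282; plan g75 l.21221 (3), l.21300 (b)–(c)).  FILE A1 of two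
(A2 = `Node00/Record13LettersOfThm1CCM`: the letters of the gauge road, the pins, the collar letter, the non-wrapping letter and the wrapping certificate, the history clauses).
NEW leaf; node00-def-K0a's FILES 13a (`Record13NumericsOfThm1CC1`), 9 (`Record13LiveSelectorFamily`) and 21 (`Record13SepCoPInhabitedOfThm1CoPGauge`, imported for its
chain) CONSUMED BY NAME, nothing modified; the unit branch `theta13OfThm1CC1` (`M = M₁ = 1`) is untouched — this member is ADDITIVE.  `--kind definition --supports stmt-QuantumFields-20541`.
[15] = [Balaban1985Variational], [6] = [Balaban1985RegularSpaces], [III] = [Balaban1988Convergent], [I] = [Balaban1987RG1], [IV] = [Balaban1989LargeFieldI].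

WHY.  dag-n07-e's road to the K0 stub «[15] Sect. F (9)-line-1 step» goes through [6] Prop. 6 at NODE 00's cube member (`TorusCoverPropSixGauge`,
`gauge152R_of_prop6`), whose collared cube `□̃` of side `M + 2ρ`, `ρ = R₁M₁ ≥ L`, `11d < M` must project into the support `hullD M₁ 1 (Ω 1)`: this forces the COLLAR
LETTER `(11·d + 3·L)·L ≤ ν.M₁` inside the step facts' `∀ν`-binder — the R-twins `Gauge152OfClassTopStepR F N Sup M c B₉ a₀` ∕ `Gauge9RegSepTopStepR F N Sup M c B₃ B₃' a₀ a₁`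
carry `c ≤ ν.M₁` right after `0 < ν.M₁`.  K0a's witness of record `θ₁₅ᶜᶜ¹ = theta13OfThm1CC1 F N ε₀ ε₂₉ B₃ B₃' a₀ a₁` is the UNIT branch (`ν.M₁ = 1`, `τ9.M = 1`), so an
R-keyed closer has no witness there; the record's provisos pin `hM : ∃ a, θ.τ9.M = F.L ^ a` and `hM₁ : θ.ν.M₁ ∣ θ.τ9.M` force the re-pin to a POWER of `L` with `M₁ ∣ M`:
the simplest is `M = M₁ = L^j` (`⟨j, rfl⟩`, `dvd_refl`), and `(11·4 + 3·L)·L ≤ L^j` holds for every `j ≥ 3` once `L ≥ 9` (the family has `L ≥ 13`).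

WHAT THIS FILE PROVIDES (definitions + `rfl` views + elementary faces).
* §1 `numerics7OfThm1CCM L j ε₀ B₃ B₃' a₀ a₁ := { numerics7OfThm1CC1 … with M₁ := L ^ j }`, `towerNumericsOfThm1CCM L j := { towerNumericsOfRecord₁₂ with M := L ^ j }`,
  `stage12NumericsOfThm1CCM L j ε₀ B₃ B₃' a₀ a₁ := { stage12NumericsOfThm1CC1 … with ν := …, τ9 := … }` — `A₀ = A₀ᶜᶜ¹`, `εreg = a₀`, `p₀ = r = 1`, `γ = ½`, `s2 = sect2NumericsOfThm1C L`
  (`cB = 6L + 1`, `B = 7`, `C = M_r = cR = 1`, `β = ¼`, `lf = lfConstsOfFamily`) ALL UNCHANGED (`rfl`): the gauge road's letters never read `M` or `M₁` against `cB`∕`B·C·M_r` (those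
  were the C¹∕axial roads' `hcB`∕`hBCM`∕`hletter`, not in Cut B‴); `epsOfRecord` is `M₁`-blind (`epsOfRecord_numerics7OfThm1CCM`, `rfl`); `stage12NumericsOfThm1CCM_pos` under
  the six signs and `1 ≤ L`.
* §2 the witness `theta13OfThm1CCM F N j ε₀ ε₂₉ B₃ B₃' a₀ a₁ := theta13LiveOfNumerics F N (stage12NumericsOfThm1CCM F.L j …) ε₂₉ (ζ, Rz, Zt of record)` — a MEMBER of FILE 9's
  all-numerics family (`rfl`) — its `rfl` views (`…_M₁ : ν.M₁ = F.L ^ j`, `…_τ9_M : τ9.M = F.L ^ j`, the rest as 13a §3) and faces (`admissible_`, `hasResidualsOfRecord_`, `ztUnity_`,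
  `slotsNondegenerate₁₃_` hypothesis-free, `eight_le_L_`, `kp_tree_∕kp_large_∕kp_n10_`).
The R-keyed CLOSERS (16a's socket ∘ the (β) twin of FILE 21 §2 with `hc : c ≤ θ.ν.M₁`) are the companion FILE B, filed when dag-n07-e's R-port (β) is in the tree.

HONEST FRAMING.  Bookkeeping of a re-pinned parameter family + elementary arithmetic; the numerals are displayed choices, not Bałaban's constants; nothing of Bałaban asserted;
NOT a discharge; K0⁷ NOT closed by this file (stubs: [15] Prop. 8 top step, [6] Prop. 6 member sockets, the β-box); counts unmoved (typed 28∕28 · discharged 5∕27); one finite 𝕋⁴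
programme at fixed ε — NOT continuum ∕ OS ∕ mass gap ∕ Clay.  No `sorry`, no `axiom`, no `instance`, no `notation`.
-/

noncomputable section

open MeasureTheory
open scoped Matrix.Norms.L2Operator

namespace Literature.MathematicalPhysics.QuantumFieldTheory.Balaban1983to89.Node00

open T4Continuum B14.Eq218Concrete B15DeterminingSets B12RegularSpaces111 B14RegularSpaces234 FlowStep FlowStepRuns

/-! ## §1. The collared numerics: `ν.M₁ := L^j`, `τ9.M := L^j`, everything else the unit branch's -/

section Numerics

/-- **def-R's Stage-7 numerics OF THE COLLARED MEMBER**: the C¹-route's `numerics7OfThm1CC1 L ε₀ B₃ B₃' a₀ a₁` (`A₀ = A₀ᶜᶜ¹`, `εreg = a₀`, `p₀ = r = M₂ = 1`) with the separation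
width `M₁ := L ^ j` ([6] (1.3)–(1.6): the layers `Ω_n ∖ Ω_{n+1}` are `M₁` blocks wide — room for [6] Prop. 6's collared cube). [cite: Balaban1985RegularSpaces, (1.3)–(1.6) p.77, Prop. 6 p.99; Balaban1988Convergent, (2.4) p.255, (2.13) p.256 (bookkeeping witness)] -/
def numerics7OfThm1CCM (L j : ℕ) (ε₀ B₃ B₃' a₀ a₁ : ℝ) : Stage7Numerics :=
  { numerics7OfThm1CC1 L ε₀ B₃ B₃' a₀ a₁ with M₁ := L ^ j }

/-- **def-R's tower numerics OF THE COLLARED MEMBER**: the record's (`Nsz = Nmem = 0`) with [I]'s cube letter `M := L ^ j` (a power of `L`, as the proviso pin `hM` demands, and a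
multiple of `M₁ = L ^ j`, as `hM₁` demands). [cite: Balaban1989LargeFieldI, (2.1) p.182; Balaban1987RG1, (1.12) p.262 (bookkeeping witness)] -/
def towerNumericsOfThm1CCM (L j : ℕ) : TowerNumerics :=
  { towerNumericsOfRecord₁₂ with M := L ^ j }

/-- **THE STAGE-12 NUMERICS OF THE COLLARED MEMBER**: the C¹-route's `stage12NumericsOfThm1CC1 L ε₀ B₃ B₃' a₀ a₁` with `ν := numerics7OfThm1CCM …` and `τ9 := towerNumericsOfThm1CCM L j`
— `s2 = sect2NumericsOfThm1C L`, `γ = ½`, `A₁ = 1`, `εbg` unchanged. [cite: Balaban1988Convergent, (2.4) p.255, (2.10) p.256, (2.28) p.259, (2.38) p.261; Balaban1987RG1, (0.21) p.256, (1.12) p.262 (bookkeeping witness)] -/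
def stage12NumericsOfThm1CCM (L j : ℕ) (ε₀ B₃ B₃' a₀ a₁ : ℝ) : Stage12Numerics :=
  { stage12NumericsOfThm1CC1 L ε₀ B₃ B₃' a₀ a₁ with ν := numerics7OfThm1CCM L j ε₀ B₃ B₃' a₀ a₁, τ9 := towerNumericsOfThm1CCM L j }

variable (L j : ℕ) (ε₀ B₃ B₃' a₀ a₁ : ℝ)

/-- The separation width IS `L ^ j` (`rfl`). [cite: Balaban1985RegularSpaces, (1.3)–(1.6) p.77 (bookkeeping)] -/
theorem numerics7OfThm1CCM_M₁ : (numerics7OfThm1CCM L j ε₀ B₃ B₃' a₀ a₁).M₁ = L ^ j := rfl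

/-- The (2.17) cube factor is the unit branch's `M₂ = 1` (`rfl`). [cite: Balaban1988Convergent, (2.17) p.257 (bookkeeping)] -/
theorem numerics7OfThm1CCM_M₂ : (numerics7OfThm1CCM L j ε₀ B₃ B₃' a₀ a₁).M₂ = 1 := rfl

/-- The profile constant is the C¹ route's `A₀ᶜᶜ¹` (`rfl`). [cite: Balaban1988Convergent, (2.4) p.255 (bookkeeping)] -/
theorem numerics7OfThm1CCM_A₀ : (numerics7OfThm1CCM L j ε₀ B₃ B₃' a₀ a₁).A₀ = A0OfThm1CC1 L B₃ B₃' a₀ a₁ := rfl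

/-- The regularity threshold is `a₀` (`rfl`). [cite: Balaban1985Variational, Thm 1 p.279 (bookkeeping)] -/
theorem numerics7OfThm1CCM_εreg : (numerics7OfThm1CCM L j ε₀ B₃ B₃' a₀ a₁).εreg = a₀ := rfl

/-- The profile exponent is `p₀ = 1` (`rfl`). [cite: Balaban1988Convergent, (2.4) p.255 (bookkeeping)] -/
theorem numerics7OfThm1CCM_p₀ : (numerics7OfThm1CCM L j ε₀ B₃ B₃' a₀ a₁).p₀ = 1 := rfl

/-- The (2.5) exponent is `r = 1` (`rfl`). [cite: Balaban1988Convergent, (2.5) p.255 (bookkeeping)] -/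
theorem numerics7OfThm1CCM_r : (numerics7OfThm1CCM L j ε₀ B₃ B₃' a₀ a₁).r = 1 := rfl

/-- The (1.2) letter IS the argument (`rfl`). [cite: Balaban1987RG1, (1.2) p.260 (bookkeeping)] -/
theorem numerics7OfThm1CCM_ε₀ : (numerics7OfThm1CCM L j ε₀ B₃ B₃' a₀ a₁).ε₀ = ε₀ := rfl

/-- **THE SMALL-FIELD THRESHOLDS ARE `M₁`-BLIND**: `epsOfRecord` of the collared numerics IS the unit branch's (`rfl`; (2.4) reads `A₀`, `p₀` only). [cite: Balaban1988Convergent, (2.4) p.255 (bookkeeping)] -/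
theorem epsOfRecord_numerics7OfThm1CCM : epsOfRecord (numerics7OfThm1CCM L j ε₀ B₃ B₃' a₀ a₁) = epsOfRecord (numerics7OfThm1CC1 L ε₀ B₃ B₃' a₀ a₁) := rfl

/-- The tower's cube letter IS `L ^ j` (`rfl`). [cite: Balaban1989LargeFieldI, (2.1) p.182 (bookkeeping)] -/
theorem towerNumericsOfThm1CCM_M : (towerNumericsOfThm1CCM L j).M = L ^ j := rfl

/-- Its Stage-7 part (`rfl`). [cite: Balaban1988Convergent, (2.4) p.255 (bookkeeping)] -/
theorem stage12NumericsOfThm1CCM_ν : (stage12NumericsOfThm1CCM L j ε₀ B₃ B₃' a₀ a₁).ν = numerics7OfThm1CCM L j ε₀ B₃ B₃' a₀ a₁ := rfl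

/-- Its tower numerics (`rfl`). [cite: Balaban1989LargeFieldI, (2.1) p.182 (bookkeeping)] -/
theorem stage12NumericsOfThm1CCM_τ9 : (stage12NumericsOfThm1CCM L j ε₀ B₃ B₃' a₀ a₁).τ9 = towerNumericsOfThm1CCM L j := rfl

/-- Its cube letter `τ9.M = L ^ j` (`rfl`). [cite: Balaban1989LargeFieldI, (2.1) p.182; Balaban1987RG1, (1.12) p.262 (bookkeeping)] -/
theorem stage12NumericsOfThm1CCM_τ9_M : (stage12NumericsOfThm1CCM L j ε₀ B₃ B₃' a₀ a₁).τ9.M = L ^ j := rfl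

/-- Its separation width `ν.M₁ = L ^ j` (`rfl`). [cite: Balaban1985RegularSpaces, (1.3)–(1.6) p.77 (bookkeeping)] -/
theorem stage12NumericsOfThm1CCM_M₁ : (stage12NumericsOfThm1CCM L j ε₀ B₃ B₃' a₀ a₁).ν.M₁ = L ^ j := rfl

/-- Its §2 numerics ARE FILE 11a's `sect2NumericsOfThm1C L` (`rfl`) — `cB = 6L + 1`, `B = 7`, `C = M_r = cR = 1`, `β = ¼`. [cite: Balaban1988Convergent, (2.28) p.259 (bookkeeping)] -/
theorem stage12NumericsOfThm1CCM_s2 : (stage12NumericsOfThm1CCM L j ε₀ B₃ B₃' a₀ a₁).s2 = sect2NumericsOfThm1C L := rfl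

/-- Its window constant is `γ = ½` (`rfl`). [cite: Balaban1987RG1, Thm 1 p.259 (bookkeeping)] -/
theorem stage12NumericsOfThm1CCM_γ : (stage12NumericsOfThm1CCM L j ε₀ B₃ B₃' a₀ a₁).γ = 1 / 2 := rfl

/-- Its located regularity constant is `cR = 1` (`rfl`). [cite: Balaban1988Convergent, (2.10) p.256 (bookkeeping)] -/
theorem stage12NumericsOfThm1CCM_cR : (stage12NumericsOfThm1CCM L j ε₀ B₃ B₃' a₀ a₁).s2.cR = 1 := rfl

/-- Its (2.34) constant is `β = ¼` (`rfl`). [cite: Balaban1988Convergent, (2.34) p.261 (bookkeeping)] -/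
theorem stage12NumericsOfThm1CCM_βc : (stage12NumericsOfThm1CCM L j ε₀ B₃ B₃' a₀ a₁).s2.βc = 1 / 4 := rfl

/-- Its term constants ARE the family's (`rfl`). [cite: Balaban1988Convergent, (2.28) p.259 (bookkeeping)] -/
theorem stage12NumericsOfThm1CCM_lf : (stage12NumericsOfThm1CCM L j ε₀ B₃ B₃' a₀ a₁).s2.lf = lfConstsOfFamily := rfl

/-- Its (1.16) constant is `A₁ = 1` (`rfl`). [cite: Balaban1987RG1, (1.16) p.262 (bookkeeping)] -/
theorem stage12NumericsOfThm1CCM_A₁ : (stage12NumericsOfThm1CCM L j ε₀ B₃ B₃' a₀ a₁).A₁ = 1 := rfl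

/-- Its profile constant is `A₀ᶜᶜ¹` (`rfl`). [cite: Balaban1988Convergent, (2.4) p.255 (bookkeeping)] -/
theorem stage12NumericsOfThm1CCM_A₀ : (stage12NumericsOfThm1CCM L j ε₀ B₃ B₃' a₀ a₁).ν.A₀ = A0OfThm1CC1 L B₃ B₃' a₀ a₁ := rfl

/-- Its regularity threshold is `a₀` (`rfl`). [cite: Balaban1985Variational, Thm 1 p.279 (bookkeeping)] -/
theorem stage12NumericsOfThm1CCM_εreg : (stage12NumericsOfThm1CCM L j ε₀ B₃ B₃' a₀ a₁).ν.εreg = a₀ := rfl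

variable {L j ε₀ B₃ B₃' a₀ a₁}

/-- **THE COLLARED NUMERICS MEET EVERY SIGN WINDOW** (`Stage12Numerics.Pos`) under `1 ≤ L`, `0 < ε₀`, `0 ≤ B₃`, `0 ≤ B₃′`, `0 < a₀`, `0 < a₁` (`1 ≤ L^j = M₁ = M`).
[cite: Balaban1988Convergent, (2.4) p.255, (2.10) p.256, (2.28) p.259, (2.34)–(2.39) p.261; Balaban1987RG1, (0.21) p.256; Balaban1985Variational, Thm 1 p.279 (bookkeeping)] -/
theorem stage12NumericsOfThm1CCM_pos (hL : 1 ≤ L) (hε : 0 < ε₀) (hB : 0 ≤ B₃) (hB' : 0 ≤ B₃') (ha₀ : 0 < a₀) (ha₁ : 0 < a₁) :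
    (stage12NumericsOfThm1CCM L j ε₀ B₃ B₃' a₀ a₁).Pos := by
  have hLj : 1 ≤ L ^ j := Nat.one_le_pow j L hL
  refine ⟨⟨hε, ha₀, A0OfThm1CC1_pos hB hB' ha₀ ha₁, hLj, ?_⟩, ?_, ⟨?_, ?_⟩, hLj, ?_, sect2NumericsOfThm1C_pos L, ?_, ?_, ?_⟩ <;>
    norm_num [stage12NumericsOfThm1CCM, numerics7OfThm1CCM, towerNumericsOfThm1CCM, stage12NumericsOfThm1CC1, numerics7OfThm1CC1, sect2NumericsOfThm1C,
      stage12NumericsOfFamily, stage12NumericsOfRecord, numerics7OfFamily, numerics7OfRecord₁₂, towerNumericsOfRecord₁₂, sect2NumericsOfFamily, sect2NumericsOfRecord₁₂,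
      lfConstsOfFamily, lfConstsOfRecord₁₂]

end Numerics

/-! ## §2. ★★ THE COLLARED WITNESS `θ₁₅ᶜᶜᴹ(j) = theta13OfThm1CCM F N j ε₀ ε₂₉ B₃ B₃' a₀ a₁` and its faces -/

section Witness

variable (F : T4Family) (N : ℕ) [NeZero N] (j : ℕ) (ε₀ ε₂₉ B₃ B₃' a₀ a₁ : ℝ)

/-- **THE COLLARED STAGE-13 WITNESS** `θ₁₅ᶜᶜᴹ(j; ε₀, ε₂₉; B₃, B₃′, a₀, a₁)`: FILE 9's all-numerics live witness family AT `stage12NumericsOfThm1CCM F.L j ε₀ B₃ B₃' a₀ a₁`, with K0b's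
residuals of record — the member at which dag-n07-e's collar binder `c ≤ ν.M₁` (`c = (11·4 + 3·L)·L`) is met for `j ≥ 3` and the proviso pins read `M = L^j = M₁`.
[cite: Balaban1989LargeFieldI, (0.3) p.176 and p.177; Balaban1988Convergent, (2.4) p.255, (2.10) p.256, (2.13) p.256, (2.28) p.259, (2.38) p.261; Balaban1987RG1, (1.12) p.262; Balaban1985RegularSpaces, (1.3)–(1.6) p.77, Prop. 6 p.99; Balaban1985Variational, Thm 1 p.279 (bookkeeping witness)] -/
def theta13OfThm1CCM : Stage13Params F N :=
  theta13LiveOfNumerics F N (stage12NumericsOfThm1CCM F.L j ε₀ B₃ B₃' a₀ a₁) ε₂₉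
    (zeta316OfRecord F N (stage12NumericsOfThm1CCM F.L j ε₀ B₃ B₃' a₀ a₁).ν (stage12NumericsOfThm1CCM F.L j ε₀ B₃ B₃' a₀ a₁).τ9.M
      (stage12NumericsOfThm1CCM F.L j ε₀ B₃ B₃' a₀ a₁).A₁)
    (RzOfRecord F N) (ZtOfRecord F N)

/-- Unfolding: `θ₁₅ᶜᶜᴹ(j)` IS the member of the all-numerics family (`rfl`). [cite: Balaban1989LargeFieldI, (0.3) p.176 (bookkeeping)] -/
theorem theta13OfThm1CCM_eq :
    theta13OfThm1CCM F N j ε₀ ε₂₉ B₃ B₃' a₀ a₁ =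
      theta13LiveOfNumerics F N (stage12NumericsOfThm1CCM F.L j ε₀ B₃ B₃' a₀ a₁) ε₂₉
        (zeta316OfRecord F N (stage12NumericsOfThm1CCM F.L j ε₀ B₃ B₃' a₀ a₁).ν (stage12NumericsOfThm1CCM F.L j ε₀ B₃ B₃' a₀ a₁).τ9.M
          (stage12NumericsOfThm1CCM F.L j ε₀ B₃ B₃' a₀ a₁).A₁)
        (RzOfRecord F N) (ZtOfRecord F N) := rfl

/-- `θ₁₅ᶜᶜᴹ.ν = numerics7OfThm1CCM F.L j ε₀ B₃ B₃' a₀ a₁` (`rfl`). [cite: Balaban1988Convergent, (2.4) p.255 (bookkeeping)] -/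
theorem theta13OfThm1CCM_ν : (theta13OfThm1CCM F N j ε₀ ε₂₉ B₃ B₃' a₀ a₁).ν = numerics7OfThm1CCM F.L j ε₀ B₃ B₃' a₀ a₁ := rfl

/-- `θ₁₅ᶜᶜᴹ.ν.εreg = a₀` (`rfl`). [cite: Balaban1985Variational, Thm 1 p.279 (bookkeeping)] -/
theorem theta13OfThm1CCM_εreg : (theta13OfThm1CCM F N j ε₀ ε₂₉ B₃ B₃' a₀ a₁).ν.εreg = a₀ := rfl

/-- `θ₁₅ᶜᶜᴹ.ν.A₀ = A₀ᶜᶜ¹(F.L; B₃, B₃′, a₀, a₁)` (`rfl`). [cite: Balaban1988Convergent, (2.4) p.255 (bookkeeping)] -/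
theorem theta13OfThm1CCM_A₀ : (theta13OfThm1CCM F N j ε₀ ε₂₉ B₃ B₃' a₀ a₁).ν.A₀ = A0OfThm1CC1 F.L B₃ B₃' a₀ a₁ := rfl

/-- `θ₁₅ᶜᶜᴹ.ν.p₀ = 1` (`rfl`). [cite: Balaban1988Convergent, (2.4) p.255 (bookkeeping)] -/
theorem theta13OfThm1CCM_p₀ : (theta13OfThm1CCM F N j ε₀ ε₂₉ B₃ B₃' a₀ a₁).ν.p₀ = 1 := rfl

/-- `θ₁₅ᶜᶜᴹ.ν.r = 1` (`rfl`). [cite: Balaban1988Convergent, (2.5) p.255 (bookkeeping)] -/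
theorem theta13OfThm1CCM_r : (theta13OfThm1CCM F N j ε₀ ε₂₉ B₃ B₃' a₀ a₁).ν.r = 1 := rfl

/-- `θ₁₅ᶜᶜᴹ.ν.M₂ = 1` (`rfl`). [cite: Balaban1988Convergent, (2.17) p.257 (bookkeeping)] -/
theorem theta13OfThm1CCM_M₂ : (theta13OfThm1CCM F N j ε₀ ε₂₉ B₃ B₃' a₀ a₁).ν.M₂ = 1 := rfl

/-- **`θ₁₅ᶜᶜᴹ.ν.M₁ = F.L ^ j`** (`rfl`) — the separation width of [6] (1.3)–(1.6) at the collared witness. [cite: Balaban1985RegularSpaces, (1.3)–(1.6) p.77; Balaban1988Convergent, (2.13) p.256 (bookkeeping)] -/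
theorem theta13OfThm1CCM_M₁ : (theta13OfThm1CCM F N j ε₀ ε₂₉ B₃ B₃' a₀ a₁).ν.M₁ = F.L ^ j := rfl

/-- `θ₁₅ᶜᶜᴹ.ν.ε₀ = ε₀` (`rfl`). [cite: Balaban1987RG1, (1.2) p.260 (bookkeeping)] -/
theorem theta13OfThm1CCM_ε₀ : (theta13OfThm1CCM F N j ε₀ ε₂₉ B₃ B₃' a₀ a₁).ν.ε₀ = ε₀ := rfl

/-- `θ₁₅ᶜᶜᴹ.ε₂₉ = ε₂₉` (`rfl`). [cite: Balaban1987RG1, (2.9) p.266 (bookkeeping)] -/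
theorem theta13OfThm1CCM_ε₂₉ : (theta13OfThm1CCM F N j ε₀ ε₂₉ B₃ B₃' a₀ a₁).ε₂₉ = ε₂₉ := rfl

/-- `θ₁₅ᶜᶜᴹ.γ = ½` (`rfl`). [cite: Balaban1987RG1, Thm 1 p.259 (bookkeeping)] -/
theorem theta13OfThm1CCM_γ : (theta13OfThm1CCM F N j ε₀ ε₂₉ B₃ B₃' a₀ a₁).γ = 1 / 2 := rfl

/-- `θ₁₅ᶜᶜᴹ.s2 = sect2NumericsOfThm1C F.L` (`rfl`). [cite: Balaban1988Convergent, (2.28) p.259 (bookkeeping)] -/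
theorem theta13OfThm1CCM_s2 : (theta13OfThm1CCM F N j ε₀ ε₂₉ B₃ B₃' a₀ a₁).s2 = sect2NumericsOfThm1C F.L := rfl

/-- `θ₁₅ᶜᶜᴹ.s2.cB = 6·F.L + 1` (`rfl`). [cite: Balaban1987RG1, (1.12) p.262 (bookkeeping)] -/
theorem theta13OfThm1CCM_cB : (theta13OfThm1CCM F N j ε₀ ε₂₉ B₃ B₃' a₀ a₁).s2.cB = 6 * F.L + 1 := rfl

/-- `θ₁₅ᶜᶜᴹ.s2.B = 7` (`rfl`). [cite: Balaban1988Convergent, (2.38) p.261 (bookkeeping)] -/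
theorem theta13OfThm1CCM_B : (theta13OfThm1CCM F N j ε₀ ε₂₉ B₃ B₃' a₀ a₁).s2.B = 7 := rfl

/-- `θ₁₅ᶜᶜᴹ.s2.C = 1` (`rfl`). [cite: Balaban1988Convergent, (2.38) p.261 (bookkeeping)] -/
theorem theta13OfThm1CCM_C : (theta13OfThm1CCM F N j ε₀ ε₂₉ B₃ B₃' a₀ a₁).s2.C = 1 := rfl

/-- `θ₁₅ᶜᶜᴹ.s2.Mr = 1` (`rfl`). [cite: Balaban1988Convergent, (2.38) p.261 (bookkeeping)] -/
theorem theta13OfThm1CCM_Mr : (theta13OfThm1CCM F N j ε₀ ε₂₉ B₃ B₃' a₀ a₁).s2.Mr = 1 := rfl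

/-- `θ₁₅ᶜᶜᴹ.s2.cR = 1` (`rfl`). [cite: Balaban1988Convergent, (2.10) p.256 (bookkeeping)] -/
theorem theta13OfThm1CCM_cR : (theta13OfThm1CCM F N j ε₀ ε₂₉ B₃ B₃' a₀ a₁).s2.cR = 1 := rfl

/-- `θ₁₅ᶜᶜᴹ.s2.βc = ¼` (`rfl`). [cite: Balaban1988Convergent, (2.34) p.261 (bookkeeping)] -/
theorem theta13OfThm1CCM_βc : (theta13OfThm1CCM F N j ε₀ ε₂₉ B₃ B₃' a₀ a₁).s2.βc = 1 / 4 := rfl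

/-- `θ₁₅ᶜᶜᴹ.s2.lf.κ = 2·10⁴` (`rfl`). [cite: Balaban1987RG1, (1.18) p.263 (bookkeeping)] -/
theorem theta13OfThm1CCM_κ : (theta13OfThm1CCM F N j ε₀ ε₂₉ B₃ B₃' a₀ a₁).s2.lf.κ = 20000 := rfl

/-- The term constants of record at `θ₁₅ᶜᶜᴹ` ARE the family's with `γ = ½` (`rfl`). [cite: Balaban1988Convergent, (2.28) p.259 (bookkeeping)] -/
theorem lfOfRecord₁₂_theta13OfThm1CCM :
    lfOfRecord₁₂ F N (theta13OfThm1CCM F N j ε₀ ε₂₉ B₃ B₃' a₀ a₁).toStage12Params = { lfConstsOfFamily with γ := 1 / 2 } := rfl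

/-- **`θ₁₅ᶜᶜᴹ.τ9.M = F.L ^ j`** (`rfl`) — [I]'s cube letter at the collared witness. [cite: Balaban1989LargeFieldI, (2.1) p.182; Balaban1987RG1, (1.12) p.262 (bookkeeping)] -/
theorem theta13OfThm1CCM_τ9_M : (theta13OfThm1CCM F N j ε₀ ε₂₉ B₃ B₃' a₀ a₁).τ9.M = F.L ^ j := rfl

/-- `θ₁₅ᶜᶜᴹ.A₁ = 1` (`rfl`). [cite: Balaban1987RG1, (1.16) p.262 (bookkeeping)] -/
theorem theta13OfThm1CCM_A₁ : (theta13OfThm1CCM F N j ε₀ ε₂₉ B₃ B₃' a₀ a₁).A₁ = 1 := rfl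

/-- `θ₁₅ᶜᶜᴹ.Rz = RzOfRecord F N` (`rfl`). [cite: Balaban1988Convergent, (2.21) p.258 (bookkeeping)] -/
theorem theta13OfThm1CCM_Rz : (theta13OfThm1CCM F N j ε₀ ε₂₉ B₃ B₃' a₀ a₁).Rz = RzOfRecord F N := rfl

/-- `θ₁₅ᶜᶜᴹ.ℓ₆ + 1 = F.L`. [cite: Balaban1987RG1, (0.1) p.251 (bookkeeping)] -/
theorem theta13OfThm1CCM_ℓ₆_succ : (theta13OfThm1CCM F N j ε₀ ε₂₉ B₃ B₃' a₀ a₁).ℓ₆ + 1 = F.L := stage3OfFamily_ℓ₆_succ F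

/-- N10's Lemma-3 level-T binder at `θ₁₅ᶜᶜᴹ`: `8 ≤ θ.ℓ₆ + 1`. [cite: Balaban1987RG1, (0.1) p.251; Balaban1988RG2Cluster, (2.36) p.19] -/
theorem eight_le_L_theta13OfThm1CCM : 8 ≤ (theta13OfThm1CCM F N j ε₀ ε₂₉ B₃ B₃' a₀ a₁).ℓ₆ + 1 := eight_le_L_stage3OfFamily F

/-- Row N1 at `θ₁₅ᶜᶜᴹ`: the (D4) `tree` numeral. [cite: Balaban1987RG1, (0.25)–(0.26) p.257] -/
theorem kp_tree_theta13OfThm1CCM : 128 * Real.log 162 ≤ (theta13OfThm1CCM F N j ε₀ ε₂₉ B₃ B₃' a₀ a₁).s2.lf.κ := kp_tree_lfConstsOfFamily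

/-- Row N1 at `θ₁₅ᶜᶜᴹ`: the (D4) `large` numeral at the family's block size. [cite: Balaban1987RG1, (0.25)–(0.26) p.257; Balaban1988RG2Cluster, p.21 (after (2.39))] -/
theorem kp_large_theta13OfThm1CCM :
    10 * (64 * Real.log 162 + 1) ≤
      (((((theta13OfThm1CCM F N j ε₀ ε₂₉ B₃ B₃' a₀ a₁).ℓ₆ + 1 : ℕ) : ℝ)) / 2 - 1) * (theta13OfThm1CCM F N j ε₀ ε₂₉ B₃ B₃' a₀ a₁).s2.lf.κ := by
  rw [theta13OfThm1CCM_ℓ₆_succ, theta13OfThm1CCM_s2, sect2NumericsOfThm1C_lf]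
  have h3 : 3 ≤ F.L := by have := F.hL11; omega
  exact kp_large_lfConstsOfFamily_of_three_le h3

/-- Row N1 at `θ₁₅ᶜᶜᴹ`: N10's rate threshold. [cite: Balaban1987RG1, (1.18) p.263 (bookkeeping numeral)] -/
theorem kp_n10_theta13OfThm1CCM : (2 * 10 ^ 4 : ℝ) ≤ (theta13OfThm1CCM F N j ε₀ ε₂₉ B₃ B₃' a₀ a₁).s2.lf.κ := kp_n10_lfConstsOfFamily

/-- `θ₁₅ᶜᶜᴹ` carries K0b's residuals of record (`⟨rfl, rfl, rfl⟩`). [cite: Balaban1988Convergent, (3.16) p.268, (2.21) p.258, (3.20) p.269 (bookkeeping)] -/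
theorem hasResidualsOfRecord_theta13OfThm1CCM : (theta13OfThm1CCM F N j ε₀ ε₂₉ B₃ B₃' a₀ a₁).HasResidualsOfRecord F N :=
  hasResidualsOfRecord_theta13LiveOfNumerics F N (stage12NumericsOfThm1CCM F.L j ε₀ B₃ B₃' a₀ a₁) ε₂₉

/-- **… hence `ZtUnity` at `θ₁₅ᶜᶜᴹ`** (row Z). [cite: Balaban1988Convergent, (3.16)–(3.20) pp.268–269] -/
theorem ztUnity_theta13OfThm1CCM : (theta13OfThm1CCM F N j ε₀ ε₂₉ B₃ B₃' a₀ a₁).ZtUnity F N :=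
  ztUnity_theta13LiveOfNumerics F N (stage12NumericsOfThm1CCM F.L j ε₀ B₃ B₃' a₀ a₁) ε₂₉

variable {j ε₀ ε₂₉ B₃ B₃' a₀ a₁} in
/-- **`θ₁₅ᶜᶜᴹ` IS STAGE-13 ADMISSIBLE under the signs `0 < ε₀`, `0 < ε₂₉`, `0 ≤ B₃`, `0 ≤ B₃′`, `0 < a₀`, `0 < a₁`** (row G; `1 ≤ F.L`). [cite: Balaban1987RG1, (0.21) p.256, (1.2) p.260, (2.9) p.266; Balaban1988Convergent, (2.10) p.256; Balaban1985Variational, Thm 1 p.279 (bookkeeping witness)] -/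
theorem admissible_theta13OfThm1CCM (hε : 0 < ε₀) (hε' : 0 < ε₂₉) (hB : 0 ≤ B₃) (hB' : 0 ≤ B₃') (ha₀ : 0 < a₀) (ha₁ : 0 < a₁) :
    (theta13OfThm1CCM F N j ε₀ ε₂₉ B₃ B₃' a₀ a₁).Admissible F N :=
  admissible_theta13LiveOfNumerics F N _ _ _ (stage12NumericsOfThm1CCM_pos F.hL.2.le hε hB hB' ha₀ ha₁) hε'

/-- **★ Row P12 at `θ₁₅ᶜᶜᴹ` HYPOTHESIS-FREE** (FILE 9 v1.1). [cite: Balaban1988Convergent, (3.22) p.269, (3.24) p.270; Balaban1989LargeFieldI, (0.3)–(0.4) p.176] -/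
theorem slotsNondegenerate₁₃_theta13OfThm1CCM : (theta13OfThm1CCM F N j ε₀ ε₂₉ B₃ B₃' a₀ a₁).SlotsNondegenerate₁₃ F N :=
  slotsNondegenerate₁₃_theta13LiveOfNumerics_of_hasResiduals F N (stage12NumericsOfThm1CCM F.L j ε₀ B₃ B₃' a₀ a₁) ε₂₉

end Witness

end Literature.MathematicalPhysics.QuantumFieldTheory.Balaban1983to89.Node00

end
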